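import Mathlib
import HarnessLib

/-!
# Jensen in time for window averages of non-negative observables

Helper (`stub_jensenTimeSum`, line Sketch) for the crux
`OneFlightGossipEngine.KineticCurrentsWindowLDUniform`: for a flow `T` that is jointly measurable on
a measurable `μ`-conull set `S`, non-negative measurable observables `Yᵢ` and a window `w > 0`, the
exponential moment under `μ` of the window average `∑ᵢ w⁻¹ ∫₀ʷ Yᵢ (T_r ω) dr` is at most the
supremum over `r ∈ [0, w]` of the single-time exponential moments `∫⁻ exp (∑ᵢ Yᵢ (T_r ω)) dμ`.

The formulation is junk-safe: a summand whose time trace is not interval integrable integrates to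
`0` (`intervalIntegral.integral_undef`), which only lowers the exponent since `Yᵢ ≥ 0`.  Proof:
Jensen for `exp` with respect to the normalised Lebesgue measure on the window, pointwise in `ω`,
then Tonelli; if `μ` is an infinite measure the right-hand side is `∞` because `exp (∑ᵢ Yᵢ) ≥ 1`.
-/

noncomputable section
open MeasureTheory Set Filter
open scoped ENNReal Topology

namespace Summit.AtomisticToContinuum.HydrodynamicLimit.Theorems.KineticCurrentsWindowLDUniformSketch

/-- Jensen for the exponential in lower-integral form: `exp (∫ f dν) ≤ ∫⁻ exp f dν` for `f`
integrable with respect to a probability measure `ν` (the right-hand side is `∞` when `exp ∘ f`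
is not integrable). -/
private theorem ofReal_exp_integral_le_lintegral_exp {α : Type*} [MeasurableSpace α]
    (ν : Measure α) [IsProbabilityMeasure ν] {f : α → ℝ} (hf : Integrable f ν) :
    ENNReal.ofReal (Real.exp (∫ x, f x ∂ν)) ≤ ∫⁻ x, ENNReal.ofReal (Real.exp (f x)) ∂ν := by
  -- adapted from `KineticFluxLdDecayTilt.ofReal_exp_integral_le_lintegral`
  by_cases hi : Integrable (fun x => Real.exp (f x)) ν
  · have hJ : Real.exp (∫ x, f x ∂ν) ≤ ∫ x, Real.exp (f x) ∂ν :=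
      (convexOn_exp).map_integral_le Real.continuous_exp.continuousOn isClosed_univ
        (by simp) hf hi
    rw [← ofReal_integral_eq_lintegral_ofReal hi (ae_of_all _ fun x => (Real.exp_pos _).le)]
    exact ENNReal.ofReal_le_ofReal hJ
  · have hm : AEStronglyMeasurable (fun x => Real.exp (f x)) ν :=
      Real.continuous_exp.comp_aestronglyMeasurable hf.aestronglyMeasurable
    have h2 : ¬ HasFiniteIntegral (fun x => Real.exp (f x)) ν := fun h => hi ⟨hm, h⟩
    rw [hasFiniteIntegral_iff_enorm, not_lt, top_le_iff] at h2
    have htop : ∫⁻ x, ENNReal.ofReal (Real.exp (f x)) ∂ν = ∞ := by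
      rw [← h2]
      exact lintegral_congr fun x => (Real.enorm_eq_ofReal (Real.exp_pos _).le).symm
    rw [htop]
    exact le_top

/-- Jensen in time on a window: `exp (w⁻¹ ∫₀ʷ G) ≤ w⁻¹ ∫⁻_{(0,w]} exp G` for `G` interval
integrable on `[0, w]` and `0 < w`. -/
private theorem ofReal_exp_windowAvg_le {G : ℝ → ℝ} {w : ℝ} (hw : 0 < w)
    (hG : IntervalIntegrable G volume 0 w) :
    ENNReal.ofReal (Real.exp (w⁻¹ * ∫ r in (0 : ℝ)..w, G r)) ≤
      ENNReal.ofReal w⁻¹ * ∫⁻ r in Ioc 0 w, ENNReal.ofReal (Real.exp (G r)) := by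
  set ν : Measure ℝ := ENNReal.ofReal w⁻¹ • volume.restrict (Ioc 0 w) with hν
  haveI : IsProbabilityMeasure ν := by
    constructor
    rw [hν, Measure.smul_apply, Measure.restrict_apply_univ, Real.volume_Ioc, sub_zero,
      smul_eq_mul, ← ENNReal.ofReal_mul (inv_nonneg.2 hw.le), inv_mul_cancel₀ hw.ne',
      ENNReal.ofReal_one]
  have hGν : Integrable G ν := hG.1.integrable.smul_measure ENNReal.ofReal_ne_top
  have h1 : w⁻¹ * ∫ r in (0 : ℝ)..w, G r = ∫ r, G r ∂ν := by
    rw [intervalIntegral.integral_of_le hw.le, hν, integral_smul_measure,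
      ENNReal.toReal_ofReal (inv_nonneg.2 hw.le), smul_eq_mul]
  have h2 : ∫⁻ r, ENNReal.ofReal (Real.exp (G r)) ∂ν =
      ENNReal.ofReal w⁻¹ * ∫⁻ r in Ioc 0 w, ENNReal.ofReal (Real.exp (G r)) := by
    rw [hν, lintegral_smul_measure, smul_eq_mul]
  rw [h1, ← h2]
  exact ofReal_exp_integral_le_lintegral_exp ν hGν

/-- Pointwise junk-safe Jensen in time for a sum of non-negative time traces: summands that are
not interval integrable integrate to `0` and are dropped, which only lowers the exponent. -/
private theorem ofReal_exp_sum_windowAvg_le {n : ℕ} (g : Fin n → ℝ → ℝ)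
    (hg0 : ∀ i r, 0 ≤ g i r) {w : ℝ} (hw : 0 < w) :
    ENNReal.ofReal (Real.exp (∑ i, w⁻¹ * ∫ r in (0 : ℝ)..w, g i r)) ≤
      ENNReal.ofReal w⁻¹ * ∫⁻ r in Ioc 0 w, ENNReal.ofReal (Real.exp (∑ i, g i r)) := by
  have key : ∀ i, ∃ g' : ℝ → ℝ, IntervalIntegrable g' volume 0 w ∧
      (∫ r in (0 : ℝ)..w, g i r) = (∫ r in (0 : ℝ)..w, g' r) ∧ ∀ r, g' r ≤ g i r := by
    intro i
    by_cases h : IntervalIntegrable (g i) volume 0 w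
    · exact ⟨g i, h, rfl, fun r => le_rfl⟩
    · exact ⟨fun _ => 0, intervalIntegrable_const, by
        rw [intervalIntegral.integral_undef h]; simp, fun r => hg0 i r⟩
  choose g' hg'i hg'eq hg'le using key
  have hsum : ∑ i, w⁻¹ * ∫ r in (0 : ℝ)..w, g i r = w⁻¹ * ∫ r in (0 : ℝ)..w, ∑ i, g' i r := by
    rw [intervalIntegral.integral_finsetSum fun i _ => hg'i i, Finset.mul_sum]
    exact Finset.sum_congr rfl fun i _ => by rw [hg'eq i]
  have hint : IntervalIntegrable (fun r => ∑ i, g' i r) volume 0 w := by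
    have := IntervalIntegrable.sum Finset.univ fun i (_ : i ∈ Finset.univ) => hg'i i
    rwa [Finset.sum_fn] at this
  calc ENNReal.ofReal (Real.exp (∑ i, w⁻¹ * ∫ r in (0 : ℝ)..w, g i r))
      = ENNReal.ofReal (Real.exp (w⁻¹ * ∫ r in (0 : ℝ)..w, ∑ i, g' i r)) := by rw [hsum]
    _ ≤ ENNReal.ofReal w⁻¹ * ∫⁻ r in Ioc 0 w, ENNReal.ofReal (Real.exp (∑ i, g' i r)) :=
        ofReal_exp_windowAvg_le hw hint
    _ ≤ ENNReal.ofReal w⁻¹ * ∫⁻ r in Ioc 0 w, ENNReal.ofReal (Real.exp (∑ i, g i r)) :=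
        mul_le_mul_right (lintegral_mono fun r => ENNReal.ofReal_le_ofReal
          (Real.exp_le_exp.2 (Finset.sum_le_sum fun i _ => hg'le i r))) _

/-- A function on a product `Ω × β` that is measurable on `S × β`, for a measurable `μ`-conull set
`S`, is a.e.-measurable for `μ.prod ρ` (modify it to `0` off `S × β`). -/
private theorem aemeasurable_prod_of_measurable_subtype {Ω β : Type*} [MeasurableSpace Ω]
    [MeasurableSpace β] {μ : Measure Ω} (ρ : Measure β) [SFinite ρ] {S : Set Ω}
    (hS : MeasurableSet S) (hμS : μ Sᶜ = 0) {F : Ω × β → ℝ≥0∞}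
    (hF : Measurable fun q : S × β => F ((q.1 : Ω), q.2)) : AEMeasurable F (μ.prod ρ) := by
  have hs : MeasurableSet (Prod.fst ⁻¹' S : Set (Ω × β)) := measurable_fst hS
  -- the modification: `F` on `S × β`, `0` elsewhere
  refine ⟨(Prod.fst ⁻¹' S).indicator F, measurable_of_restrict_of_restrict_compl hs ?_ ?_, ?_⟩
  · have h1 : (Prod.fst ⁻¹' S).restrict ((Prod.fst ⁻¹' S).indicator F) =
        (fun q : S × β => F ((q.1 : Ω), q.2)) ∘
          fun q : (Prod.fst ⁻¹' S : Set (Ω × β)) => (⟨(q : Ω × β).1, q.2⟩, (q : Ω × β).2) := by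
      funext q
      exact indicator_of_mem q.2 F
    rw [h1]
    exact hF.comp ((measurable_subtype_coe.fst.subtype_mk).prodMk measurable_subtype_coe.snd)
  · have h2 : (Prod.fst ⁻¹' S)ᶜ.restrict ((Prod.fst ⁻¹' S).indicator F) = fun _ => 0 := by
      funext q
      exact indicator_of_notMem q.2 F
    rw [h2]
    exact measurable_const
  · have hae : ∀ᵐ p ∂(μ.prod ρ), p ∈ (Prod.fst ⁻¹' S : Set (Ω × β)) := by
      rw [ae_iff]
      have h3 : {p : Ω × β | ¬ p ∈ (Prod.fst ⁻¹' S : Set (Ω × β))} = Sᶜ ×ˢ univ := by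
        ext p
        simp
      rw [h3, Measure.prod_prod, hμS, zero_mul]
    filter_upwards [hae] with p hp
    exact (indicator_of_mem hp F).symm

/-- **Jensen in time.** For a flow `T` jointly measurable on a measurable conull set `S`,
non-negative measurable `Yᵢ` and a window `0 < w`, the exponential moment of the window average
`∑ᵢ w⁻¹ ∫₀ʷ Yᵢ (T_r ω) dr` is bounded by the supremum over `r ∈ [0, w]` of the single-time
exponential moments (junk-safe: non-integrable time traces contribute `0`). -/
theorem stub_jensenTimeSum :
    ∀ (Ω : Type) [MeasurableSpace Ω] (μ : Measure Ω) (S : Set Ω), MeasurableSet S → μ Sᶜ = 0 →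
      ∀ (T : ℝ → Ω → Ω), Measurable (fun p : S × ℝ => T p.2 (p.1 : Ω)) →
      ∀ (n : ℕ) (Y : Fin n → Ω → ℝ), (∀ i, Measurable (Y i)) → (∀ i ω, 0 ≤ Y i ω) →
      ∀ w : ℝ, 0 < w →
        ∫⁻ ω, ENNReal.ofReal (Real.exp (∑ i, w⁻¹ * ∫ r in (0 : ℝ)..w, Y i (T r ω))) ∂μ ≤
          ⨆ r ∈ Set.Icc (0 : ℝ) w, ∫⁻ ω, ENNReal.ofReal (Real.exp (∑ i, Y i (T r ω))) ∂μ := by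
  intro Ω _ μ S hS hμS T hT n Y hYm hY0 w hw
  -- the single-time integrands and the supremum of their moments over the window
  set H : ℝ → Ω → ℝ≥0∞ := fun r ω => ENNReal.ofReal (Real.exp (∑ i, Y i (T r ω))) with hH
  -- Step 1: pointwise (junk-safe) Jensen in time
  have hpt : ∀ ω, ENNReal.ofReal (Real.exp (∑ i, w⁻¹ * ∫ r in (0 : ℝ)..w, Y i (T r ω))) ≤
      ENNReal.ofReal w⁻¹ * ∫⁻ r in Ioc 0 w, H r ω := fun ω =>
    ofReal_exp_sum_windowAvg_le (fun i r => Y i (T r ω)) (fun i r => hY0 i _) hw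
  -- Step 2: every single-time moment is below the supremum, and is at least `μ univ`
  have hle : ∀ r ∈ Ioc (0 : ℝ) w, ∫⁻ ω, H r ω ∂μ ≤ ⨆ r ∈ Set.Icc (0 : ℝ) w, ∫⁻ ω, H r ω ∂μ :=
    fun r hr => le_biSup (fun r => ∫⁻ ω, H r ω ∂μ) (Ioc_subset_Icc_self hr)
  rcases eq_top_or_lt_top (μ univ) with htop | hfin
  · -- infinite `μ`: the right-hand side is `∞` since `H 0 ≥ 1`
    have h0 : ∫⁻ ω, H 0 ω ∂μ = ∞ := by
      refine eq_top_iff.2 ?_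
      calc (⊤ : ℝ≥0∞) = ∫⁻ _, (1 : ℝ≥0∞) ∂μ := by rw [lintegral_one, htop]
        _ ≤ ∫⁻ ω, H 0 ω ∂μ := lintegral_mono fun ω =>
            ENNReal.one_le_ofReal.2 (Real.one_le_exp (Finset.sum_nonneg fun i _ => hY0 i _))
    calc ∫⁻ ω, ENNReal.ofReal (Real.exp (∑ i, w⁻¹ * ∫ r in (0 : ℝ)..w, Y i (T r ω))) ∂μ
        ≤ ⊤ := le_top
      _ = ∫⁻ ω, H 0 ω ∂μ := h0.symm
      _ ≤ ⨆ r ∈ Set.Icc (0 : ℝ) w, ∫⁻ ω, H r ω ∂μ :=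
          le_biSup (fun r => ∫⁻ ω, H r ω ∂μ) (left_mem_Icc.2 hw.le)
  · -- finite `μ`: Tonelli
    haveI : IsFiniteMeasure μ := ⟨hfin⟩
    have hHm : AEMeasurable (Function.uncurry fun ω r => H r ω)
        (μ.prod (volume.restrict (Ioc 0 w))) := by
      refine aemeasurable_prod_of_measurable_subtype _ hS hμS ?_
      show Measurable fun q : S × ℝ => H q.2 q.1
      rw [hH]
      exact (Finset.measurable_sum _ fun i _ => (hYm i).comp hT).exp.ennreal_ofReal
    calc ∫⁻ ω, ENNReal.ofReal (Real.exp (∑ i, w⁻¹ * ∫ r in (0 : ℝ)..w, Y i (T r ω))) ∂μ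
        ≤ ∫⁻ ω, ENNReal.ofReal w⁻¹ * (∫⁻ r in Ioc 0 w, H r ω) ∂μ := lintegral_mono hpt
      _ = ENNReal.ofReal w⁻¹ * ∫⁻ r in Ioc 0 w, (∫⁻ ω, H r ω ∂μ) := by
          rw [lintegral_const_mul' _ _ ENNReal.ofReal_ne_top,
            lintegral_lintegral_swap (f := fun ω r => H r ω) hHm]
      _ ≤ ENNReal.ofReal w⁻¹ *
          ∫⁻ _ in Ioc (0 : ℝ) w, (⨆ r ∈ Set.Icc (0 : ℝ) w, ∫⁻ ω, H r ω ∂μ) :=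
          mul_le_mul_right (setLIntegral_mono' measurableSet_Ioc hle) _
      _ = ⨆ r ∈ Set.Icc (0 : ℝ) w, ∫⁻ ω, H r ω ∂μ := by
          rw [setLIntegral_const, Real.volume_Ioc, sub_zero, mul_left_comm,
            ← ENNReal.ofReal_mul (inv_nonneg.2 hw.le), inv_mul_cancel₀ hw.ne',
            ENNReal.ofReal_one, mul_one]

end Summit.AtomisticToContinuum.HydrodynamicLimit.Theorems.KineticCurrentsWindowLDUniformSketch
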